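import Summits.BirchSwinnertonDyer.BirchSwinnertonDyer.Theorems.ByReductionTypeAtTwoRankOneAtTwoOneDoorLawFloatDefs
import Summits.BirchSwinnertonDyer.BirchSwinnertonDyer.Theorems.ByReductionTypeAtTwoRankOneAtTwoOneDoorLawFirstLayerDefs
import Summits.BirchSwinnertonDyer.BirchSwinnertonDyer.Theorems.ByReductionTypeAtTwoRankOneAtTwoBigImageOddLocalOneDoorSubslicePosDisc
import Summits.BirchSwinnertonDyer.BirchSwinnertonDyer.Theorems.ByReductionTypeAtTwoRankOneAtTwoBigImageOddLocalOneDoorSubsliceNegDisc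
import HarnessLib

/-!
# Route ByReductionTypeAtTwo, crux `RankOneAtTwoBigImageOddLocal` (stmt-BirchSwinnertonDyer-23715), LINE v8.17 `one_door_analytic`:
# BRIDGE between the two Defs modules — the lead's sign-free R₀⁺ ⟺ the width seat's sign-split R⁻_float ∧ R⁺_float (modulo print), and the residue names

Width prover seat `bsd-line-fkl-p2` g14 (2026-08-28), `--supports stmt-BirchSwinnertonDyer-23715` (helper).  THEOREMS ONLY; BSD is not proved by any of this.
Two statements files name the v8.17 inputs: the lead g16's `…OneDoorLawFirstLayerDefs.lean` (R₀⁺ `HeegnerExponentAtSelmerTrivialMinimalDoorAtTwo` — ONE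
sign-free floating-exponent statement at every `Sel₂`-trivial MINIMAL door, with `(d_K, N_W) = 1` and the Heegner hypothesis as binders; R_S
`DoorIndexLawFullCAtTwoSomeDoorResidueSha`, R_N `DoorIndexLawFullCAtTwoSomeDoorResidueNonEgg` — the REGISTERED stubs) and this seat's
`…OneDoorLawFloatDefs.lean` (R⁻_float `HeegnerExponentFloatNegDiscAtTwo` at transposition-admissible doors, R⁺_float `HeegnerExponentFloatEggAtTwo` at
desc-admissible doors of egg curves; `LawfulDoorOfShaTwoNontrivialAtTwo`, `LawfulDoorOfPosDiscNonEggAtTwo` with bodies byte-identical to R_S, R_N).  This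
file records that they say the same thing, so theorems over either set of names are interchangeable:

* `lawfulDoorOfShaTwoNontrivial_iff_residueSha`, `lawfulDoorOfPosDiscNonEgg_iff_residueNonEgg` (`Iff.rfl`);
* `floats_of_heegnerExponentMinimalDoor` — R₀⁺ ⟹ R⁻_float ∧ R⁺_float (a transposition-admissible or desc-admissible door is door-admissible and minimal; `(d_K, N_W) = 1`
  and Heegner follow from door-admissibility: `satisfiesHeegnerHypothesis_of_doorAdmissible`, `GenusKoly.heegner_isCoprime_conductorNorm_discr`) — UNCONDITIONAL;
* `heegnerExponentMinimalDoor_of_floats` — R⁻_float ∧ R⁺_float ⟹ R₀⁺ modulo the four primary printed facts (a minimal door at `Δ_W < 0` is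
  transposition-admissible at its one transposition prime, fkl-p2 g13's `transpAdmissible_of_doorAdmissible_of_counts`; at `Δ_W > 0` it is desc-admissible,
  `descAdmissible_of_doorAdmissible_of_counts_eq_zero`, and a `Sel₂`-trivial desc-admissible twin of a rank-one `Ш[2] = 0` curve forces `MeetsEgg` by T-C
  `GenusKolyArch.eggTwistLawAtTwo_holds`; rank one from Gross–Zagier + Kolyvagin + modularity + Hoffstein–Luo).

References: [GrossLMS1991] §10; [Kramer1981] Prop. 3, Prop. 6; [MazurRubin2010] Cor. 3.4 (i); [Zhang2014CJM] Thm. 1.1 (shape).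
-/

set_option autoImplicit false
-- the Theorems namespace of this sub repeats the summit name by design (D-0017 nested layout)
set_option linter.dupNamespace false

noncomputable section

open scoped Classical

namespace Summit.BirchSwinnertonDyer.BirchSwinnertonDyer.Theorems.RankOneAtTwoOneDoor

open WeierstrassCurve NumberField Literature.NumberTheory.EllipticCurves Literature.NumberTheory.EllipticCurves.ModularForms
  Summit.BirchSwinnertonDyer.Rank1Residual.F1Sign2
  Summit.BirchSwinnertonDyer.Rank1Residual.F1Sign2.TranspositionDoor
open Summit.BirchSwinnertonDyer.BirchSwinnertonDyer.Theorems.GenusKolyArch (eggTwistLawAtTwo_holds)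

/-- The width seat's R_S name and the lead's registered stub R_S are the same statement. [cite: GrossLMS1991, Conj. 1.2 and §10] -/
theorem lawfulDoorOfShaTwoNontrivial_iff_residueSha : LawfulDoorOfShaTwoNontrivialAtTwo ↔ DoorIndexLawFullCAtTwoSomeDoorResidueSha := Iff.rfl

/-- The width seat's R_N name and the lead's registered stub R_N are the same statement. [cite: GrossLMS1991, Conj. 1.2 and §10] -/
theorem lawfulDoorOfPosDiscNonEgg_iff_residueNonEgg : LawfulDoorOfPosDiscNonEggAtTwo ↔ DoorIndexLawFullCAtTwoSomeDoorResidueNonEgg := Iff.rfl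

/-- **R₀⁺ ⟹ R⁻_float ∧ R⁺_float (UNCONDITIONAL).**  A transposition-admissible door (`Δ_W < 0`) is door-admissible (`ANg16.doorAdmissible_of_transpAdmissible`) and
minimal (`minimal_of_transpAdmissible`); a desc-admissible door (`Δ_W > 0`) is door-admissible (`ANg16.doorAdmissible_of_descAdmissible`) and minimal
(`minimal_of_descAdmissible_of_pos`); in both cases the Heegner hypothesis (`satisfiesHeegnerHypothesis_of_doorAdmissible`) and `(d_K, N_W) = 1`
(`GenusKoly.heegner_isCoprime_conductorNorm_discr`) follow, so the lead's sign-free R₀⁺ applies. [cite: Kramer1981, Prop. 3 and Prop. 6] [cite: GrossLMS1991, §10] -/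
theorem floats_of_heegnerExponentMinimalDoor (h : HeegnerExponentAtSelmerTrivialMinimalDoorAtTwo) :
    HeegnerExponentFloatNegDiscAtTwo ∧ HeegnerExponentFloatEggAtTwo := by
  refine ⟨?_, ?_⟩
  · intro W _ _ _ hCM hsurj hT hc hr hΔ hSha K _ _ hK q₀ _ htr hsel Dt H ι P hP
    have hadm : DoorAdmissible W (NumberField.discr K) := ANg16.doorAdmissible_of_transpAdmissible W htr
    have hmin : transpCount W (NumberField.discr K) + 2 * identCount W (NumberField.discr K) = (if W.Δ < 0 then 1 else 0) :=
      minimal_of_transpAdmissible W htr hΔ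
    have hHN : SatisfiesHeegnerHypothesis (W.conductorNorm ℤ) K := satisfiesHeegnerHypothesis_of_doorAdmissible W K hK hadm
    have hcop : Nat.Coprime (NumberField.discr K).natAbs (W.conductorNorm ℤ) := by
      have h1 := Summit.BirchSwinnertonDyer.BirchSwinnertonDyer.Theorems.GenusKoly.heegner_isCoprime_conductorNorm_discr (W := W) hK hHN
      have h2 := Int.isCoprime_iff_gcd_eq_one.mp h1
      rw [Int.gcd_eq_natAbs, Int.natAbs_natCast] at h2
      exact Nat.Coprime.symm h2
    exact h W hCM hsurj hT hc hr hSha K hK hadm hmin hcop hHN hsel Dt H ι P hP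
  · intro W _ _ _ hCM hsurj hT hc hr hΔ hSha _ K _ _ hK hDA hsel Dt H ι P hP
    have hadm : DoorAdmissible W (NumberField.discr K) := ANg16.doorAdmissible_of_descAdmissible W hDA
    have hmin : transpCount W (NumberField.discr K) + 2 * identCount W (NumberField.discr K) = (if W.Δ < 0 then 1 else 0) :=
      minimal_of_descAdmissible_of_pos W hΔ hDA
    have hHN : SatisfiesHeegnerHypothesis (W.conductorNorm ℤ) K := satisfiesHeegnerHypothesis_of_doorAdmissible W K hK hadm
    have hcop : Nat.Coprime (NumberField.discr K).natAbs (W.conductorNorm ℤ) := by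
      have h1 := Summit.BirchSwinnertonDyer.BirchSwinnertonDyer.Theorems.GenusKoly.heegner_isCoprime_conductorNorm_discr (W := W) hK hHN
      have h2 := Int.isCoprime_iff_gcd_eq_one.mp h1
      rw [Int.gcd_eq_natAbs, Int.natAbs_natCast] at h2
      exact Nat.Coprime.symm h2
    exact h W hCM hsurj hT hc hr hSha K hK hadm hmin hcop hHN hsel Dt H ι P hP

/-- **R⁻_float ∧ R⁺_float ⟹ R₀⁺, modulo the four primary printed facts** (Gross–Zagier, Kolyvagin, modularity, Hoffstein–Luo — only for `rank E(ℚ) = 1` at `Δ_W > 0`).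
At a `Sel₂`-trivial MINIMAL door: if `Δ_W < 0` then `t = 1`, `s = 0`, the one transposition prime `q₀ ∣ d_K` makes the door transposition-admissible
(`transpAdmissible_of_doorAdmissible_of_counts`) and R⁻_float applies; if `Δ_W > 0` then `t = s = 0`, the door is desc-admissible
(`descAdmissible_of_doorAdmissible_of_counts_eq_zero`) and `MeetsEgg W` holds — otherwise T-C `eggTwistLawAtTwo_holds` would give `#Sel₂(W^{(d_K)}) = 4 ≠ 1` — so R⁺_float
applies.  CONDITIONAL by design. [cite: Kramer1981, Prop. 3 and Prop. 6] [cite: MazurRubin2010, Cor. 3.4 (i)] [cite: GrossLMS1991, §10] -/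
theorem heegnerExponentMinimalDoor_of_floats
    (hGZ : ∀ (N : ℕ) [NeZero N] (W : WeierstrassCurve ℚ) (K : Type) [Field K] [NumberField K], gross_zagier N W K)
    (hKo : ∀ (N : ℕ) [NeZero N] (W : WeierstrassCurve ℚ) (K : Type) [Field K] [NumberField K], kolyvagin N W K)
    (hnf : exists_isNewformOf) (hHL : HoffsteinLuo1997_exists_twist_L_one_ne_zero)
    (hRf : HeegnerExponentFloatNegDiscAtTwo) (hPf : HeegnerExponentFloatEggAtTwo) : HeegnerExponentAtSelmerTrivialMinimalDoorAtTwo := by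
  intro W _ _ _ hCM hsurj hT hc hr hSha K _ _ hK hadm hmin _ _ hsel Dt H ι P hP
  rcases lt_or_gt_of_ne W.isUnit_Δ.ne_zero with hΔ | hΔ
  · -- `Δ_W < 0`: one transposition prime
    rw [if_pos hΔ] at hmin
    have ht : transpCount W (NumberField.discr K) = 1 := by omega
    have hs : identCount W (NumberField.discr K) = 0 := by omega
    have ht' := ht
    unfold transpCount at ht'
    obtain ⟨q₀, hq₀⟩ := Finset.card_eq_one.mp ht'
    have hmem : q₀ ∈ (NumberField.discr K).natAbs.primeFactors.filter fun q => jacobiSym W.Δ.num q = -1 := by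
      rw [hq₀]; exact Finset.mem_singleton_self _
    obtain ⟨hpf, hjac⟩ := Finset.mem_filter.mp hmem
    have hq₀p : q₀.Prime := Nat.prime_of_mem_primeFactors hpf
    have hq₀d : (q₀ : ℤ) ∣ NumberField.discr K := Int.ofNat_dvd_left.mpr (Nat.dvd_of_mem_primeFactors hpf)
    haveI : Fact q₀.Prime := ⟨hq₀p⟩
    have htr : TranspAdmissible W (NumberField.discr K) q₀ := transpAdmissible_of_doorAdmissible_of_counts W hadm ht hs hq₀p hq₀d hjac
    exact hRf W hCM hsurj hT hc hr hΔ hSha K hK q₀ htr hsel Dt H ι P hP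
  · -- `Δ_W > 0`: desc-admissible, and the egg bit is forced by T-C
    rw [if_neg (not_lt.mpr hΔ.le)] at hmin
    have ht : transpCount W (NumberField.discr K) = 0 := by omega
    have hs : identCount W (NumberField.discr K) = 0 := by omega
    have hDA : DescAdmissible W (NumberField.discr K) := descAdmissible_of_doorAdmissible_of_counts_eq_zero W hadm ht hs
    have hT2 : NoRationalTwoTorsion W := noRationalTwoTorsion_of_odd_torsionOrder W hT
    have hrk : W.mordellWeilRank = 1 := (mordellWeilRank_eq_one_of_analyticRank_eq_one_of_isGloballyMinimal hGZ hKo hnf hHL W hr).1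
    have hme : MeetsEgg W := by
      by_contra hne
      have h4 := (eggTwistLawAtTwo_holds W hΔ hT2 hrk hSha _ hDA).2 hne
      omega
    exact hPf W hCM hsurj hT hc hr hΔ hSha hme K hK hDA hsel Dt H ι P hP

/-- **The lead's losslessness currency and this seat's agree**: modulo the four primary printed facts, R₀⁺ ⟺ R⁻_float ∧ R⁺_float.  CONDITIONAL by design.
[cite: GrossLMS1991, §10] [cite: Kramer1981, Prop. 6] -/
theorem heegnerExponentMinimalDoor_iff_floats
    (hGZ : ∀ (N : ℕ) [NeZero N] (W : WeierstrassCurve ℚ) (K : Type) [Field K] [NumberField K], gross_zagier N W K)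
    (hKo : ∀ (N : ℕ) [NeZero N] (W : WeierstrassCurve ℚ) (K : Type) [Field K] [NumberField K], kolyvagin N W K)
    (hnf : exists_isNewformOf) (hHL : HoffsteinLuo1997_exists_twist_L_one_ne_zero) :
    HeegnerExponentAtSelmerTrivialMinimalDoorAtTwo ↔ (HeegnerExponentFloatNegDiscAtTwo ∧ HeegnerExponentFloatEggAtTwo) :=
  ⟨floats_of_heegnerExponentMinimalDoor, fun h => heegnerExponentMinimalDoor_of_floats hGZ hKo hnf hHL h.1 h.2⟩

end Summit.BirchSwinnertonDyer.BirchSwinnertonDyer.Theorems.RankOneAtTwoOneDoor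

end
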